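import Summits.Parity.BatemanHorn.Theorems.SoloInformedThinTypeI
import Literature.Barriers.Parity.FordMaynardPrimeSievesMinimalTypeII
import HarnessLib

/-!
# Thin sequences vs. Type-I information, VI: every comparison model with prime mass; the local obstruction

Solo unit `solo-Parity-informed` (ideation tier, informed mode), session 26; `PLAN.md` §34, CLAIMS C104.
Part of the `SoloInformedThin*` series (Theorem D of `paper/SHARPEST-STATEMENT.md`).

`SoloInformedThinTypeI` proved the Type-I half of Theorem D in the tree's formalisation of
Ford–Maynard's axiom (I) (`Literature.Barriers.Parity.FordMaynard.TypeI`) with the comparison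
sequence `b = 1`: a real sequence `a` with at most `x^{1-c}` non-zero values on `(x/2, x]` has
`w = a − 1` violating (I) at every level `x^γ`, `γ > 1 − c`.  Two things are added here.

1. **Model-robustness.**  The mechanism — a prime `p ∈ (M, 2M]`, `M` a little above `x^{1-c}`,
   generically divides NO element of the support, so the `m = p` term of (I) returns the model's
   whole mass on the multiples of `p` — does not care what the model is.  `typeI_sparse_model_le`
   and `eventually_not_typeI_of_sparse_model` prove: for EVERY comparison sequence `b : ℕ → ℝ`,
   if `w = a − b` satisfies (I) at level `x^γ` then the mass of `b` on the multiples of the primes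
   of a dyadic block `(M, 2M]`, `x^{1-c} log² x ≤ M ≤ x^γ/2`, is at most `x/(log x)^B` plus the
   share of the `≤ #A·log x/log M` exceptional primes; so (I) FAILS as soon as `b` puts mass
   `≥ β·x/log M` on such a block with no prime carrying more than `R₀·x/M` of it (`β, R₀` fixed,
   `B > 1`, `x` large).  Every model in use has this prime mass: `b = 1` by Chebyshev
   (`exists_card_primes_Ioc_two_mul_ge`), the local model `b(n) ≍ ρ_f`-weighted densities of the
   values of a polynomial `f` by the prime ideal theorem (mean of `ρ_f(p)` is `1`) — the latter is
   literature, not formalised here.  This is the (I)-clause of Theorem D for the models a sieve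
   would actually use, not only for `b = 1`.  Consistency / non-vacuity is the companion file
   `SoloInformedThinTypeIModelOne`: both mass hypotheses hold for `b = 1` on the block
   `M = ⌈x^{1-c} log² x⌉`, which re-derives the `b = 1` theorem of `SoloInformedThinTypeI` from the
   model-robust one.
2. **The local obstruction** (`abs_modelMass_le_of_typeI`, `eventually_not_typeI_of_forall_not_dvd`,
   `eventually_not_typeI_sq_add_one_of_pos`).  If ONE modulus `m` divides no element of the
   support — for the values of `k² + 1`, `m = 3` — then the `m`-term alone returns the model's mass
   on the multiples of `m`; against `b = 1` that is `≥ x/(2m) − 1`, and (I) fails at EVERY level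
   `x^γ`, `γ > 0`.  So against the constant model the values of an actual polynomial fail (I) for a
   trivial local reason long before the level `x^{1-c}`; the threshold `γ = 1 − c` of Theorem D is
   a statement about thin supports in general (it is attained by generic ones) and, for polynomial
   values, about models carrying the right local densities (item 1).  Honest label: item 2 is a
   remark on the formalisation's choice `b = 1`, recorded so that the scope of Theorem D's
   (I)-clause is stated by a theorem rather than by prose.

References: [cite: FordMaynard2024PrimeSieves, §1 (I); §2.4 (p. 7)].
-/

noncomputable section

open Filter Finset Real

namespace Summit.Parity.BatemanHorn.Theorems

open Literature.Barriers.Parity.FordMaynard (TypeI eventually_mul_rpow_le_rpow)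

/-- The mass of the comparison sequence `b` on the multiples of `m` in `(x/2, x]`, indexed by the
cofactor exactly as in (I) with the interval `I(m) = [1, x]`:
`modelMass b x m = ∑_{1 ≤ n ≤ x, x/2 < m n ≤ x} b(m n)`. -/
def modelMass (b : ℕ → ℝ) (x : ℝ) (m : ℕ) : ℝ :=
  ∑ n ∈ (Icc 1 ⌊x⌋₊).filter (fun n : ℕ => x / 2 < (m * n : ℝ) ∧ (m * n : ℝ) ≤ x), b (m * n)

/-- For the constant model `b = 1` the mass on the multiples of `m ≥ 1` is the number of
`n` with `x/2 < m n ≤ x`, at least `x/(2m) − 1`. -/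
theorem sub_one_le_modelMass_one {x : ℝ} (hx : 0 ≤ x) {m : ℕ} (hm : 0 < m) :
    x / (2 * m) - 1 ≤ modelMass (fun _ => (1 : ℝ)) x m := by
  unfold modelMass
  rw [sum_const, nsmul_eq_mul, mul_one]
  have hsub : Ioc ⌊x / (2 * m)⌋₊ ⌊x / m⌋₊ ⊆
      (Icc 1 ⌊x⌋₊).filter (fun n : ℕ => x / 2 < (m * n : ℝ) ∧ (m * n : ℝ) ≤ x) := by
    intro r hr
    obtain ⟨hr1, h1, h2⟩ := mem_Ioc_cofactor hx hm hr
    simp only [Finset.mem_filter, mem_Icc]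
    refine ⟨⟨hr1, Nat.le_floor ?_⟩, h1, h2⟩
    have hm1 : (1 : ℝ) ≤ m := by exact_mod_cast hm
    have : (r : ℝ) ≤ m * r := le_mul_of_one_le_left (Nat.cast_nonneg _) hm1
    linarith
  exact (sub_one_le_card_Ioc_cofactor hx hm).trans (by exact_mod_cast card_le_card hsub)

/-! ### One modulus outside the support returns the model's mass -/

/-- **The `m`-term of (I).**  If `m ∈ [1, x^γ]` divides no element of the support of `a` on
`(x/2, x]` and `w = a − b` satisfies (I) at level `x^γ`, then `|modelMass b x m| ≤ x/(log x)^B`: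
the single term `m` of (I), with `I(m) = [1, x]`, is `τ(m)^B·|−modelMass b x m|`.
[cite: FordMaynard2024PrimeSieves, §1 (I)] -/
theorem abs_modelMass_le_of_typeI {a b : ℕ → ℝ} {x γ B : ℝ} (hB : 0 ≤ B) {m : ℕ} (hm : 0 < m)
    (hmγ : (m : ℝ) ≤ x ^ γ)
    (ha : ∀ v : ℕ, x / 2 < (v : ℝ) → (v : ℝ) ≤ x → a v ≠ 0 → ¬ m ∣ v)
    (h : TypeI (fun n : ℕ => a n - b n) x γ B) :
    |modelMass b x m| ≤ x / Real.log x ^ B := by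
  set T : Finset ℕ := Icc 1 ⌊x⌋₊ with hTdef
  set Nw : ℕ → Finset ℕ := fun m : ℕ =>
    T.filter (fun n : ℕ => x / 2 < (m * n : ℝ) ∧ (m * n : ℝ) ≤ x) with hNw
  have key : ∑ m ∈ Icc 1 ⌊x ^ γ⌋₊, ((m.divisors.card : ℝ) ^ B) *
      |∑ n ∈ Nw m, (a (m * n) - b (m * n))| ≤ x / Real.log x ^ B := h (fun _ => (1, ⌊x⌋₊))
  have hmem : m ∈ Icc 1 ⌊x ^ γ⌋₊ := by
    rw [mem_Icc]; exact ⟨hm, Nat.le_floor hmγ⟩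
  have hzero : ∀ n ∈ Nw m, a (m * n) = 0 := by
    intro n hn
    have hn' := hn
    simp only [hNw, Finset.mem_filter] at hn'
    by_contra hne
    have hne' : a (m * n) ≠ 0 := hne
    exact ha (m * n) (by exact_mod_cast hn'.2.1) (by exact_mod_cast hn'.2.2) hne' (dvd_mul_right m n)
  have hinner : ∑ n ∈ Nw m, (a (m * n) - b (m * n)) = -modelMass b x m := by
    unfold modelMass
    rw [← Finset.sum_neg_distrib]
    refine sum_congr rfl fun n hn => ?_
    rw [hzero n hn]
    ring
  have hcardpos : 0 < m.divisors.card :=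
    Finset.card_pos.mpr ⟨1, Nat.one_mem_divisors.mpr (by omega)⟩
  have hτ1 : (1 : ℝ) ≤ (m.divisors.card : ℝ) := by exact_mod_cast hcardpos
  have hτ : (1 : ℝ) ≤ (m.divisors.card : ℝ) ^ B := Real.one_le_rpow hτ1 hB
  have hterm : |modelMass b x m| ≤
      ((m.divisors.card : ℝ) ^ B) * |∑ n ∈ Nw m, (a (m * n) - b (m * n))| := by
    rw [hinner, abs_neg]
    exact le_mul_of_one_le_left (abs_nonneg _) hτ
  have hsingle : ((m.divisors.card : ℝ) ^ B) * |∑ n ∈ Nw m, (a (m * n) - b (m * n))| ≤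
      ∑ m ∈ Icc 1 ⌊x ^ γ⌋₊, ((m.divisors.card : ℝ) ^ B) *
        |∑ n ∈ Nw m, (a (m * n) - b (m * n))| :=
    single_le_sum (f := fun m : ℕ => ((m.divisors.card : ℝ) ^ B) *
        |∑ n ∈ Nw m, (a (m * n) - b (m * n))|)
      (fun m _ => mul_nonneg (Real.rpow_nonneg (Nat.cast_nonneg _) _) (abs_nonneg _)) hmem
  exact hterm.trans (hsingle.trans key)

/-- **A local obstruction kills (I) against `b = 1` at every level.**  Let `m ≥ 1`, `γ > 0`,
`B > 0`.  For all large `x`: no real sequence whose support on `(x/2, x]` avoids the multiples of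
`m` has `w = a − 1` satisfying (I) at level `x^γ` (the `m`-term alone is `≥ x/(2m) − 1 > x/(log x)^B`).
[cite: FordMaynard2024PrimeSieves, §1 (I)] -/
theorem eventually_not_typeI_of_forall_not_dvd {m : ℕ} (hm : 0 < m) {γ B : ℝ} (hγ : 0 < γ)
    (hB : 0 < B) :
    ∀ᶠ x : ℝ in atTop, ∀ a : ℕ → ℝ,
      (∀ v : ℕ, x / 2 < (v : ℝ) → (v : ℝ) ≤ x → a v ≠ 0 → ¬ m ∣ v) →
      ¬ TypeI (fun n : ℕ => a n - 1) x γ B := by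
  have hmr : (0 : ℝ) < m := by exact_mod_cast hm
  filter_upwards [eventually_gt_atTop (4 * (m : ℝ)),
    (tendsto_rpow_atTop hγ).eventually_ge_atTop (m : ℝ),
    ((tendsto_rpow_atTop hB).comp Real.tendsto_log_atTop).eventually_ge_atTop (4 * (m : ℝ))]
    with x hx4 hxγ hlog a ha hI
  have hx0 : 0 ≤ x := by linarith
  have hlogB : 4 * (m : ℝ) ≤ Real.log x ^ B := hlog
  have hlogB0 : 0 < Real.log x ^ B := by linarith
  have h1 : |modelMass (fun _ => (1 : ℝ)) x m| ≤ x / Real.log x ^ B :=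
    abs_modelMass_le_of_typeI (b := fun _ => (1 : ℝ)) hB.le hm hxγ ha hI
  have h2 : x / (2 * m) - 1 ≤ |modelMass (fun _ => (1 : ℝ)) x m| :=
    (sub_one_le_modelMass_one hx0 hm).trans (le_abs_self _)
  have h3 : x / Real.log x ^ B ≤ x / (4 * m) :=
    div_le_div_of_nonneg_left hx0 (by positivity) hlogB
  have h4 : x / (4 * m) < x / (2 * m) - 1 := by
    rw [div_lt_iff₀ (by positivity)]
    have : (x / (2 * m) - 1) * (4 * m) = 2 * x - 4 * m := by
      field_simp
      ring
    rw [this]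
    linarith
  linarith

/-- **The `n² + 1` case, every level.**  `k² + 1` is never divisible by `3`; hence for every
`γ > 0`, `B > 0` and all large `x`, no weighting of the numbers `k² + 1` in `(x/2, x]` has
`w = a − 1` satisfying (I) at level `x^γ` — against the constant model the operative obstruction is
local, not the thinness threshold `γ = 1/2` of `eventually_not_typeI_sq_add_one`.
[cite: FordMaynard2024PrimeSieves, §1 (I)] -/
theorem eventually_not_typeI_sq_add_one_of_pos {γ B : ℝ} (hγ : 0 < γ) (hB : 0 < B) :
    ∀ᶠ x : ℝ in atTop, ∀ a : ℕ → ℝ,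
      (∀ v : ℕ, x / 2 < (v : ℝ) → (v : ℝ) ≤ x → a v ≠ 0 → ∃ k, k ^ 2 + 1 = v) →
      ¬ TypeI (fun n : ℕ => a n - 1) x γ B := by
  have h3 : ∀ k : ℕ, ¬ 3 ∣ k ^ 2 + 1 := by
    intro k
    rw [Nat.dvd_iff_mod_eq_zero, Nat.add_mod, Nat.pow_mod]
    have hk : k % 3 < 3 := Nat.mod_lt _ (by norm_num)
    generalize k % 3 = r at hk ⊢
    interval_cases r <;> decide
  filter_upwards [eventually_not_typeI_of_forall_not_dvd (m := 3) (by norm_num) hγ hB]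
    with x hx a ha
  refine hx a fun v hv1 hv2 hav => ?_
  obtain ⟨k, hk⟩ := ha v hv1 hv2 hav
  rw [← hk]
  exact h3 k

/-! ### Every model with prime mass: the (I)-clause of Theorem D, model-robust -/

/-- **(I) against a thin support, arbitrary model.**  Let `S` be a finite set of primes
`M < p ≤ x^γ`, let `A` contain the support of `a` on `(x/2, x]`, and let the model `b` put mass
`≤ R` on the multiples of each `p ∈ S`.  If `w = a − b` satisfies (I) at level `x^γ`, then
`∑_{p ∈ S} modelMass b x p − (#A · log x / log M) · R ≤ x/(log x)^B` — the primes of `S` dividing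
no element of the support return their whole model mass. [cite: FordMaynard2024PrimeSieves, §2.4] -/
theorem typeI_sparse_model_le {a b : ℕ → ℝ} {x γ B : ℝ} (hB : 0 ≤ B) (hx : 1 ≤ x) {M R : ℝ}
    (hM : 1 < M) (hR : 0 ≤ R) (S A : Finset ℕ)
    (hS : ∀ p ∈ S, p.Prime ∧ M < (p : ℝ) ∧ (p : ℝ) ≤ x ^ γ)
    (hA : ∀ v : ℕ, x / 2 < (v : ℝ) → (v : ℝ) ≤ x → a v ≠ 0 → v ∈ A)
    (hbR : ∀ p ∈ S, modelMass b x p ≤ R)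
    (h : TypeI (fun n : ℕ => a n - b n) x γ B) :
    ∑ p ∈ S, modelMass b x p - A.card * (Real.log x / Real.log M) * R
      ≤ x / Real.log x ^ B := by
  set L := Real.log x / Real.log M with hL
  set T : Finset ℕ := Icc 1 ⌊x⌋₊ with hTdef
  set Nw : ℕ → Finset ℕ := fun m : ℕ =>
    T.filter (fun n : ℕ => x / 2 < (m * n : ℝ) ∧ (m * n : ℝ) ≤ x) with hNw
  have key : ∑ m ∈ Icc 1 ⌊x ^ γ⌋₊, ((m.divisors.card : ℝ) ^ B) *
      |∑ n ∈ Nw m, (a (m * n) - b (m * n))| ≤ x / Real.log x ^ B := h (fun _ => (1, ⌊x⌋₊))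
  -- bad primes `Sb` (some cofactor carries a non-zero value of `a`) and good primes `Sg`
  set Sb : Finset ℕ := S.filter (fun p : ℕ => ∃ r : ℕ, r ∈ T ∧
      (x / 2 < (p * r : ℝ) ∧ (p * r : ℝ) ≤ x) ∧ a (p * r) ≠ 0) with hSb
  set Sg : Finset ℕ := S.filter (fun p : ℕ => ¬ ∃ r : ℕ, r ∈ T ∧
      (x / 2 < (p * r : ℝ) ∧ (p * r : ℝ) ≤ x) ∧ a (p * r) ≠ 0) with hSg
  have hS' : ∀ p ∈ S, p.Prime ∧ M < (p : ℝ) := fun p hp => ⟨(hS p hp).1, (hS p hp).2.1⟩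
  have hSsub : S ⊆ Icc 1 ⌊x ^ γ⌋₊ := fun p hp => by
    rw [mem_Icc]; exact ⟨(hS p hp).1.one_le, Nat.le_floor (hS p hp).2.2⟩
  have hSgS : Sg ⊆ S := by rw [hSg]; exact filter_subset _ _
  have hSbS : Sb ⊆ S := by rw [hSb]; exact filter_subset _ _
  have hL0 : 0 ≤ L := div_nonneg (Real.log_nonneg hx) (Real.log_nonneg hM.le)
  -- good primes: each returns at least its model mass
  have hgoodterm : ∀ p ∈ Sg, modelMass b x p ≤
      ((p.divisors.card : ℝ) ^ B) * |∑ n ∈ Nw p, (a (p * n) - b (p * n))| := by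
    intro p hp
    have hp' := hp
    simp only [hSg, Finset.mem_filter] at hp'
    obtain ⟨hpS, hg⟩ := hp'
    have hpr := (hS p hpS).1
    have hzero : ∀ n ∈ Nw p, a (p * n) = 0 := by
      intro n hn
      have hn' := hn
      simp only [hNw, Finset.mem_filter] at hn'
      by_contra hne
      exact hg ⟨n, hn'.1, hn'.2, hne⟩
    have hinner : ∑ n ∈ Nw p, (a (p * n) - b (p * n)) = -modelMass b x p := by
      unfold modelMass
      rw [← Finset.sum_neg_distrib]
      refine sum_congr rfl fun n hn => ?_
      rw [hzero n hn]
      ring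
    rw [hinner, abs_neg]
    have hcardpos : 0 < p.divisors.card :=
      Finset.card_pos.mpr ⟨1, Nat.one_mem_divisors.mpr hpr.ne_zero⟩
    have hτ1 : (1 : ℝ) ≤ (p.divisors.card : ℝ) := by exact_mod_cast hcardpos
    have hτ : (1 : ℝ) ≤ (p.divisors.card : ℝ) ^ B := Real.one_le_rpow hτ1 hB
    exact (le_abs_self _).trans (le_mul_of_one_le_left (abs_nonneg _) hτ)
  have h1 : ∑ p ∈ Sg, modelMass b x p ≤ x / Real.log x ^ B :=
    calc ∑ p ∈ Sg, modelMass b x p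
        ≤ ∑ p ∈ Sg, ((p.divisors.card : ℝ) ^ B) * |∑ n ∈ Nw p, (a (p * n) - b (p * n))| :=
          sum_le_sum hgoodterm
      _ ≤ ∑ m ∈ Icc 1 ⌊x ^ γ⌋₊, ((m.divisors.card : ℝ) ^ B) *
            |∑ n ∈ Nw m, (a (m * n) - b (m * n))| :=
          sum_le_sum_of_subset_of_nonneg (hSgS.trans hSsub)
            (fun m _ _ => mul_nonneg (Real.rpow_nonneg (Nat.cast_nonneg _) _) (abs_nonneg _))
      _ ≤ x / Real.log x ^ B := key
  -- bad primes: at most `#A · L` of them, each of model mass at most `R`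
  have h2 : (Sb.card : ℝ) ≤ A.card * L :=
    card_badPrimes_le hx hM S T A Sb hS' hA (fun p hp => by
      have hp' := hp
      simp only [hSb, Finset.mem_filter] at hp'
      exact hp')
  have h3 : ∑ p ∈ Sb, modelMass b x p ≤ Sb.card * R := by
    rw [← nsmul_eq_mul, ← sum_const]
    exact sum_le_sum fun p hp => hbR p (hSbS hp)
  have hsplit : ∑ p ∈ Sb, modelMass b x p + ∑ p ∈ Sg, modelMass b x p =
      ∑ p ∈ S, modelMass b x p := by
    rw [hSb, hSg]
    exact sum_filter_add_sum_filter_not S _ _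
  have h4 : (Sb.card : ℝ) * R ≤ A.card * L * R := mul_le_mul_of_nonneg_right h2 hR
  linarith

/-- **No Type-I information above the density, against any model with prime mass.**  Let
`c ≤ 1`, `γ > 1 − c`, `B > 1`, `β > 0`, `R₀ ≥ 0`.  For all large `x`, for every real sequence
`a` with at most `x^{1-c}` non-zero values on `(x/2, x]`, every comparison sequence `b`, and every
dyadic block of primes `(M, 2M]` with `x^{1-c}·log² x ≤ M ≤ x^γ/2` on which `b` has mass
`≥ β·x/log M` in total and `≤ R₀·x/M` per prime: `w = a − b` violates (I) at level `x^γ`.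
(`b = 1`: mass `≍ x/log M` by Chebyshev; the local model of the values of a polynomial `f`:
mass `≍ x/log M` by the prime ideal theorem — so for these models the Type-I level of a support
of `x^{1-c}` points is at most `x^{1-c}`.) [cite: FordMaynard2024PrimeSieves, §2.4] -/
theorem eventually_not_typeI_of_sparse_model {c γ B β R₀ : ℝ} (hc1 : c ≤ 1)
    (hγ : 1 - c < γ) (hB : 1 < B) (hβ : 0 < β) (hR₀ : 0 ≤ R₀) :
    ∀ᶠ x : ℝ in atTop, ∀ (a b : ℕ → ℝ) (A : Finset ℕ) (M : ℕ),
      (A.card : ℝ) ≤ x ^ (1 - c) →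
      (∀ v : ℕ, x / 2 < (v : ℝ) → (v : ℝ) ≤ x → a v ≠ 0 → v ∈ A) →
      x ^ (1 - c) * Real.log x ^ 2 ≤ (M : ℝ) → 2 * (M : ℝ) ≤ x ^ γ →
      (∀ p : ℕ, p.Prime → M < p → p ≤ 2 * M → modelMass b x p ≤ R₀ * x / M) →
      β * x / Real.log M ≤ ∑ p ∈ (Ioc M (2 * M)).filter Nat.Prime, modelMass b x p →
      ¬ TypeI (fun n : ℕ => a n - b n) x γ B := by
  have hγ0 : 0 < γ := by linarith
  set K : ℝ := γ / (4 * β) with hKdef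
  have hK0 : 0 < K := by positivity
  filter_upwards [eventually_gt_atTop (1 : ℝ),
    Real.tendsto_log_atTop.eventually_gt_atTop (1 : ℝ),
    Real.tendsto_log_atTop.eventually_ge_atTop (2 * R₀ / β),
    ((tendsto_rpow_atTop (by linarith : 0 < B - 1)).comp
      Real.tendsto_log_atTop).eventually_gt_atTop (8 * K)]
    with x hx1 hlx1 hlxR hlxB a b A M hA hcov hMlo hMhi hbR hbβ hI
  have hx0 : 0 < x := by linarith
  have hx1' : 1 ≤ x := hx1.le
  have hlx0 : 0 < Real.log x := by linarith
  have hx1c : 1 ≤ x ^ (1 - c) := Real.one_le_rpow hx1' (by linarith)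
  have hx1c0 : 0 < x ^ (1 - c) := by linarith
  -- the scale `M`
  have hMge : Real.log x ^ 2 ≤ (M : ℝ) := by
    have : Real.log x ^ 2 ≤ x ^ (1 - c) * Real.log x ^ 2 :=
      le_mul_of_one_le_left (by positivity) hx1c
    linarith
  have hM1 : 1 < (M : ℝ) := by nlinarith
  have hM0 : 0 < (M : ℝ) := by linarith
  have hlM0 : 0 < Real.log M := Real.log_pos hM1
  have hMxγ : (M : ℝ) ≤ x ^ γ := by linarith
  have hlogM : Real.log M ≤ γ * Real.log x := by
    rw [← Real.log_rpow hx0]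
    exact Real.log_le_log hM0 hMxγ
  have hγlx : 0 < γ * Real.log x := mul_pos hγ0 hlx0
  -- the finitary inequality on the dyadic block
  set S : Finset ℕ := (Ioc M (2 * M)).filter Nat.Prime with hSdef
  have hS : ∀ p ∈ S, p.Prime ∧ (M : ℝ) < (p : ℝ) ∧ (p : ℝ) ≤ x ^ γ := by
    intro p hp
    rw [hSdef, mem_filter, mem_Ioc] at hp
    refine ⟨hp.2, by exact_mod_cast hp.1.1, ?_⟩
    have : (p : ℝ) ≤ 2 * M := by exact_mod_cast hp.1.2
    linarith
  have hR : 0 ≤ R₀ * x / M := by positivity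
  have hbR' : ∀ p ∈ S, modelMass b x p ≤ R₀ * x / M := by
    intro p hp
    rw [hSdef, mem_filter, mem_Ioc] at hp
    exact hbR p hp.2 hp.1.1 hp.1.2
  have hfin := typeI_sparse_model_le (zero_le_one.trans hB.le) hx1' hM1 hR S A hS hcov hbR' hI
  -- the exceptional primes carry at most `(β/2)·x/log M`
  have hbad : (A.card : ℝ) * (Real.log x / Real.log M) * (R₀ * x / M) ≤
      β / 2 * x / Real.log M := by
    have s1 : (A.card : ℝ) * (Real.log x / Real.log M) * (R₀ * x / M) ≤
        x ^ (1 - c) * (Real.log x / Real.log M) * (R₀ * x / M) := by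
      have h0 : 0 ≤ (Real.log x / Real.log M) * (R₀ * x / M) := by positivity
      nlinarith
    have s2 : x ^ (1 - c) * (Real.log x / Real.log M) * (R₀ * x / M) =
        (x ^ (1 - c) / M) * (R₀ * x * Real.log x / Real.log M) := by ring
    have s3 : x ^ (1 - c) / M ≤ 1 / Real.log x ^ 2 := by
      rw [div_le_div_iff₀ hM0 (by positivity)]
      linarith
    have s4 : (x ^ (1 - c) / M) * (R₀ * x * Real.log x / Real.log M) ≤
        (1 / Real.log x ^ 2) * (R₀ * x * Real.log x / Real.log M) :=
      mul_le_mul_of_nonneg_right s3 (by positivity)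
    have s5 : (1 / Real.log x ^ 2) * (R₀ * x * Real.log x / Real.log M) =
        (R₀ / Real.log x) * (x / Real.log M) := by
      field_simp
    have s6 : R₀ / Real.log x ≤ β / 2 := by
      rw [div_le_iff₀ hlx0]
      have := hlxR
      rw [div_le_iff₀ hβ] at this
      linarith
    have s7 : (R₀ / Real.log x) * (x / Real.log M) ≤ (β / 2) * (x / Real.log M) :=
      mul_le_mul_of_nonneg_right s6 (by positivity)
    have s8 : (β / 2) * (x / Real.log M) = β / 2 * x / Real.log M := by ring
    linarith
  -- hence `(β/2)·x/log M ≤ x/(log x)^B`, absurd for `B > 1`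
  have hq : β / 2 * x / Real.log M = (1 / 2) * (β * x / Real.log M) := by ring
  have hmain : β / 2 * x / Real.log M ≤ x / Real.log x ^ B := by linarith
  have hlow : β / 2 * x / (γ * Real.log x) ≤ β / 2 * x / Real.log M :=
    div_le_div_of_nonneg_left (by positivity) hlM0 hlogM
  have hlt : x / Real.log x ^ B < x / (8 * K * Real.log x) := div_log_rpow_lt hK0 hx1 hlxB
  have hKeq : x / (8 * K * Real.log x) = β / 2 * x / (γ * Real.log x) := by
    rw [hKdef]
    field_simp
    ring
  linarith

end Summit.Parity.BatemanHorn.Theorems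

end
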